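import Summits.QuantumFields.BalabanUV.Beta.EriceRemainderEnclosureHistoryAutonomyComparisonAgeCompositionAgeRatioWindow
import Summits.QuantumFields.BalabanUV.Beta.EriceRemainderEnclosureHistoryAutonomyComparisonAgeCompositionYoungBelowCluster

/-!
# EriceRemainderEnclosureHistoryAutonomyComparisonAgeCompositionAgeRatioWindowClusters — (E112b) route (N), first order: THE LOGARITHMIC WINDOW BOUND AS A
# BLOCK CAP, AND ONE YOUNG AGE BELOW AN ARBITRARY DENSE CLUSTER OF BOUNDED SPAN.  (E112a) proved `T ≤ 1` for every profile inside `[k₀, 53·k₀]`; its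
# proof gives more: the ages in `[k₀, K)` carry at most `c(K,k₀) = (√2∕2)(1 + ⅛·log((k₀+K−1)∕(2k₀)))` at every pin (**`total_load_le_log_of_age_window`**),
# and the same holds for those ages INSIDE ANY LARGER PROFILE — the restricted profile is dominated by the same memory (**`cluster_load_le_log`**,
# `cluster_load_le_one`): a CAP for every dense block, whatever its number of ages — `≤ 0.7684` for span `3` (`K−1 ≤ 3k₀`), `≤ 0.83` for span `7`, `≤ 0.902`
# for span `17` (`window_const_two ∕ _four ∕ _nine`).  These are exactly the DISPLAYED cluster-load margins of (E91c) `flow_nonneg_young_below_cluster` (one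
# young age `i` far below an arbitrary old cluster `[k₀, K)`: `Σ_{j≥k₀} x_j ≤ 1 − δ` at every pin and `10·i ≤ δ·k₀` ⟹ `0 ≤ ε ≤ e`), hence
# **`flow_nonneg_young_below_window_cluster`** and its instances: ONE YOUNG AGE `i ≥ 1` AND ANY SET OF AGES INSIDE `[k₀, 3k₀]` WITH `k₀ ≥ 44·i`
# (`_span_three`), INSIDE `[k₀, 7k₀]` WITH `k₀ ≥ 59·i` (`_span_seven`), INSIDE `[k₀, 17k₀]` WITH `k₀ ≥ 103·i` (`_span_seventeen`) — every horizon, every damping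
# of the self-consistent class — with NO hypothesis left on the loads.

Cell `pub-balaban`, β-function sub-cell, BINDER row D4 «RemainderConst leaves for Bałaban's split» (`HOME/BINDER-OWNERS.md`; owner lineage `b2b-balaban-beta-an4`;
this file by co-owner #2 lineage `b2b-balaban-beta-d4-p2`, generation 93), β-FLOW TEAM duty (1), FREEZE (0) honoured (def-free; imports (E112a) `…AgeRatioWindow` and
(E91c) `…YoungBelowCluster`; uses (E112a) `sigma_facts` ∕ `sum_defect_le_log` ∕ `load_le_chain_share_from` ∕ `chain_const_le_sqrt_two`, (E90d) `chain_shares_le`,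
(E91c) `flow_nonneg_young_below_cluster` BY NAME; nothing restated).

HONEST FRAMING (page 1, verbatim and binding).  *"Discharging BetaPertH makes Bałaban's UV stability UNCONDITIONAL — a real constructive-QFT result; it is
NOT the continuum limit and NOT the Clay problem."*  THIS FILE DISCHARGES NOTHING OF THE KIND.  Elementary real analysis about ABSTRACT functionals on a box
]0,γ]^ℕ with displayed floors, profiles and signs, and the FIRST-ORDER renewal objects of route (N) built from them — hypotheses of a census, not facts; the
form, signs, ages and moments of Bałaban's (1.22) limit functional are NOT PRINTED ([I] p. 298; GAPS G-t4-U2-1∕-2) and NOT asserted.  Row D4 class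
UNCHANGED (critical-path width 0; instance 0∕1; D4 DISCHARGE NO DATE).  HONEST DEPENDENCY: continuum YM on T⁴ ⇐ BetaPertH ∧ nine spine estimates (0/9
proved); BetaPertH ⇐ (D1) ∧ (D4) ∧ CAP+tail; G-an2-4 gates asym, D1 and NE2/3/4.

THE POINT (README `HOME/b2b-balaban-beta-d4-p2/g93/README.md` §2–§3).  NOT CLAIMED: clusters of span beyond `53`; young PAIRS below a cluster; anything printed
— NOT B12 Thm 2, NOT BetaPertH, NOT continuum, NOT Clay.

WHAT IS PROVED ([folklore]; 0 `def`, 0 sorry).  §1 **`total_load_le_log_of_age_window`**, **`cluster_load_le_log`**, `cluster_load_le_one`.  §2 `sqrt_two_div_two_le`,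
`log_three_le`, `window_const_two`, `window_const_four`, `window_const_nine`.  §3 **`flow_nonneg_young_below_window_cluster`**, **`…_span_three`**, **`…_span_seven`**,
**`…_span_seventeen`**.
-/
noncomputable section
open Finset

namespace Summit.QuantumFields.BalabanUV.Beta.EriceRemainderEnclosureHistoryAutonomyComparisonAgeCompositionAgeRatioWindowClusters

open Literature.MathematicalPhysics.QuantumFieldTheory.Balaban1983to89
open Literature.MathematicalPhysics.QuantumFieldTheory.Balaban1983to89.T4BetaStationary
open Literature.MathematicalPhysics.QuantumFieldTheory.Balaban1983to89.T4BetaFlowWellPosed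
open Summit.QuantumFields.BalabanUV.Beta.EriceRemainderEnclosureHistoryAutonomyComparisonAgeCompositionChainShares (chain_shares_le)
open Summit.QuantumFields.BalabanUV.Beta.EriceRemainderEnclosureHistoryAutonomyComparisonAgeCompositionAgeRatioWindow
open Summit.QuantumFields.BalabanUV.Beta.EriceRemainderEnclosureHistoryAutonomyComparisonAgeCompositionYoungBelowCluster (flow_nonneg_young_below_cluster)

variable {B : (ℕ → ℝ) → ℝ} {γ b gIR : ℝ} {L : ℕ → ℝ} {K : ℕ} {h g : ℕ → ℝ}

/-! ## §1 The logarithmic window bound, also inside a larger profile -/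

/-- **THE LOGARITHMIC WINDOW BOUND.**  The hypotheses of (E112a) `total_load_le_one_of_age_ratio` with ANY `K ≥ k₀ + 1` instead of `K ≤ 53·k₀ + 1`:
`Σ_{k<K} k·L_kh(m+k)³∕2 ≤ (√2∕2)·(1 + (log(k₀+K−1) − log(2k₀))∕8)` at every pin — the chain sum of `load_le_chain_share_from` ∕ `chain_shares_le` telescoped by
`sum_defect_le_log` (`2k₀ + n = k₀ + K − 1` for `K = k₀ + n + 1`). [folklore] -/
theorem total_load_le_log_of_age_window (hmono : ∀ u v : ℕ → ℝ, SeqBox γ u → SeqBox γ v → (∀ j, u j ≤ v j) → B u ≤ B v)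
    (hL : ∀ k, 0 ≤ L k) (hb : 0 < b) (hlo : ∀ u, SeqBox γ u → b ≤ B u) (hdom : ∀ u, SeqBox γ u → ∑ k ∈ range K, L k * u k ≤ B u)
    (hh : SeqBox γ h) (hf : MemFlow B gIR h) {k₀ : ℕ} (hk₀ : 1 ≤ k₀) (hsupp : ∀ k, k < k₀ → L k = 0) (hK : k₀ + 1 ≤ K) (m : ℕ) :
    ∑ k ∈ range K, (k : ℝ) * (L k * h (m + k) ^ 3 / 2)
      ≤ Real.sqrt 2 / 2 * (1 + (Real.log ((k₀ : ℝ) + K - 1) - Real.log (2 * (k₀ : ℝ))) / 8) := by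
  have hpos : ∀ n, 0 < h n := fun n => (hh n).1
  have hk : (1 : ℝ) ≤ k₀ := by exact_mod_cast hk₀
  obtain ⟨n, rfl⟩ : ∃ n, K = k₀ + (n + 1) := ⟨K - k₀ - 1, by omega⟩
  have eK : (k₀ : ℝ) + ((k₀ + (n + 1) : ℕ) : ℝ) - 1 = 2 * (k₀ : ℝ) + n := by push_cast; ring
  rw [eK]
  have hlogle : Real.log (2 * (k₀ : ℝ)) ≤ Real.log (2 * (k₀ : ℝ) + n) :=
    Real.log_le_log (by positivity) (by have : (0 : ℝ) ≤ n := Nat.cast_nonneg n; linarith)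
  have hR0 : 0 ≤ Real.sqrt 2 / 2 * (1 + (Real.log (2 * (k₀ : ℝ) + n) - Real.log (2 * (k₀ : ℝ))) / 8) := by
    have : 0 ≤ (Real.log (2 * (k₀ : ℝ) + n) - Real.log (2 * (k₀ : ℝ))) / 8 := by linarith
    positivity
  rw [sum_range_add, sum_eq_zero fun k hk' => by rw [hsupp k (mem_range.mp hk')]; simp, zero_add]
  have hσ0 : ∀ t : ℕ, 0 < Real.sqrt (Real.sqrt ((2 * (k₀ : ℝ) + t) / (2 * (k₀ : ℝ) + t + 1))) := fun t => (sigma_facts hk₀ t).1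
  have hσ1 : ∀ t : ℕ, Real.sqrt (Real.sqrt ((2 * (k₀ : ℝ) + t) / (2 * (k₀ : ℝ) + t + 1))) < 1 := fun t => (sigma_facts hk₀ t).2.1
  have hα0 : ∀ j, 0 ≤ L (k₀ + j) * Real.sqrt (h (m + 2 * (k₀ + j))) := fun j => mul_nonneg (hL _) (Real.sqrt_nonneg _)
  by_cases hz : ∑ j ∈ range (n + 1), L (k₀ + j) * Real.sqrt (h (m + 2 * (k₀ + j))) = 0
  · have hall : ∀ j ∈ range (n + 1), L (k₀ + j) * Real.sqrt (h (m + 2 * (k₀ + j))) = 0 := (sum_eq_zero_iff_of_nonneg fun j _ => hα0 j).mp hz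
    have hL0 : ∀ j ∈ range (n + 1), L (k₀ + j) = 0 := fun j hj => by
      rcases mul_eq_zero.mp (hall j hj) with h0 | h0
      · exact h0
      · exact absurd h0 (Real.sqrt_pos.2 (hpos _)).ne'
    rw [sum_eq_zero fun j hj => by rw [hL0 j hj]; simp]
    exact hR0
  have hαpos : 0 < ∑ j ∈ range (n + 1), L (k₀ + j) * Real.sqrt (h (m + 2 * (k₀ + j))) :=
    lt_of_le_of_ne (sum_nonneg fun j _ => hα0 j) (Ne.symm hz)
  have hchain := chain_shares_le hσ0 hσ1 n (fun j => L (k₀ + j) * Real.sqrt (h (m + 2 * (k₀ + j)))) hα0 hαpos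
  have htel := sum_defect_le_log hk₀ n
  have hterms := sum_le_sum fun i hi => load_le_chain_share_from hmono hL hb hlo hk₀ hdom hh hf m (mem_range.mp hi : i < n + 1)
  rw [← mul_sum] at hterms
  exact hterms.trans (mul_le_mul_of_nonneg_left (hchain.trans (by linarith)) (by positivity))

/-- **A CLUSTER INSIDE A LARGER PROFILE.**  `L ≥ 0` on the ages `< K` dominated by the isotone memory `B` with floor `b > 0` — the OTHER ages may be loaded
arbitrarily; `h` a box solution; `1 ≤ k₀`, `k₀ + 1 ≤ K' ≤ K`.  Then the ages in `[k₀, K')` carry `Σ_{k∈[k₀,K')} k·L_kh(m+k)³∕2 ≤ (√2∕2)(1 + (log(k₀+K'−1) −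
log(2k₀))∕8)` at every pin: the profile restricted to `[k₀, K')` is dominated by the same memory (`total_load_le_log_of_age_window`). [folklore] -/
theorem cluster_load_le_log (hmono : ∀ u v : ℕ → ℝ, SeqBox γ u → SeqBox γ v → (∀ j, u j ≤ v j) → B u ≤ B v)
    (hL : ∀ k, 0 ≤ L k) (hb : 0 < b) (hlo : ∀ u, SeqBox γ u → b ≤ B u) (hdom : ∀ u, SeqBox γ u → ∑ k ∈ range K, L k * u k ≤ B u)
    (hh : SeqBox γ h) (hf : MemFlow B gIR h) {k₀ K' : ℕ} (hk₀ : 1 ≤ k₀) (hK' : k₀ + 1 ≤ K') (hK'K : K' ≤ K) (m : ℕ) :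
    ∑ k ∈ Ico k₀ K', (k : ℝ) * (L k * h (m + k) ^ 3 / 2)
      ≤ Real.sqrt 2 / 2 * (1 + (Real.log ((k₀ : ℝ) + K' - 1) - Real.log (2 * (k₀ : ℝ))) / 8) := by
  have hpos : ∀ n, 0 < h n := fun n => (hh n).1
  obtain ⟨L', hL'⟩ : ∃ f : ℕ → ℝ, f = fun k => if k₀ ≤ k then L k else 0 := ⟨_, rfl⟩
  have hL'0 : ∀ k, 0 ≤ L' k := fun k => by rw [hL']; dsimp only; split_ifs; exacts [hL k, le_rfl]
  have hL'le : ∀ k, L' k ≤ L k := fun k => by rw [hL']; dsimp only; split_ifs; exacts [le_rfl, hL k]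
  have hL'lo : ∀ k, k < k₀ → L' k = 0 := fun k hk => by rw [hL']; dsimp only; rw [if_neg (by omega)]
  have hL'hi : ∀ k, k₀ ≤ k → L' k = L k := fun k hk => by rw [hL']; dsimp only; rw [if_pos hk]
  have hdom' : ∀ u, SeqBox γ u → ∑ k ∈ range K', L' k * u k ≤ B u := by
    intro u hu
    have hu0 : ∀ k, 0 ≤ u k := fun k => (hu k).1.le
    calc ∑ k ∈ range K', L' k * u k ≤ ∑ k ∈ range K', L k * u k := sum_le_sum fun k _ => mul_le_mul_of_nonneg_right (hL'le k) (hu0 k)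
      _ ≤ ∑ k ∈ range K, L k * u k := sum_le_sum_of_subset_of_nonneg (range_mono hK'K) fun k _ _ => mul_nonneg (hL k) (hu0 k)
      _ ≤ B u := hdom u hu
  have hmain := total_load_le_log_of_age_window hmono hL'0 hb hlo hdom' hh hf hk₀ hL'lo hK' m
  have hsplit := sum_range_add_sum_Ico (fun k => (k : ℝ) * (L' k * h (m + k) ^ 3 / 2)) (show k₀ ≤ K' by omega)
  rw [← hsplit, sum_eq_zero fun k hk => by rw [hL'lo k (mem_range.mp hk)]; simp, zero_add] at hmain
  rw [sum_congr rfl fun k hk => by rw [hL'hi k (mem_Ico.mp hk).1]] at hmain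
  exact hmain

/-- **A CLUSTER OF SPAN AT MOST 53 INSIDE A LARGER PROFILE CARRIES AT MOST `1`** (`cluster_load_le_log` + (E112a) `chain_const_le_sqrt_two`). [folklore] -/
theorem cluster_load_le_one (hmono : ∀ u v : ℕ → ℝ, SeqBox γ u → SeqBox γ v → (∀ j, u j ≤ v j) → B u ≤ B v)
    (hL : ∀ k, 0 ≤ L k) (hb : 0 < b) (hlo : ∀ u, SeqBox γ u → b ≤ B u) (hdom : ∀ u, SeqBox γ u → ∑ k ∈ range K, L k * u k ≤ B u)
    (hh : SeqBox γ h) (hf : MemFlow B gIR h) {k₀ K' : ℕ} (hk₀ : 1 ≤ k₀) (hK' : k₀ + 1 ≤ K') (hK'K : K' ≤ K) (h53 : K' ≤ 53 * k₀ + 1) (m : ℕ) :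
    ∑ k ∈ Ico k₀ K', (k : ℝ) * (L k * h (m + k) ^ 3 / 2) ≤ 1 := by
  have hk : (1 : ℝ) ≤ k₀ := by exact_mod_cast hk₀
  have h1 := cluster_load_le_log hmono hL hb hlo hdom hh hf hk₀ hK' hK'K m
  have hratio : ((k₀ : ℝ) + K' - 1) / (2 * (k₀ : ℝ)) ≤ 27 := by
    rw [div_le_iff₀ (by positivity)]
    have : ((K' : ℕ) : ℝ) ≤ ((53 * k₀ + 1 : ℕ) : ℝ) := by exact_mod_cast h53
    push_cast at this
    linarith
  have hpos' : (0 : ℝ) < (k₀ : ℝ) + K' - 1 := by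
    have : ((k₀ + 1 : ℕ) : ℝ) ≤ ((K' : ℕ) : ℝ) := by exact_mod_cast hK'
    push_cast at this
    linarith
  have hconst := chain_const_le_sqrt_two (show (0 : ℝ) < ((k₀ : ℝ) + K' - 1) / (2 * (k₀ : ℝ)) by positivity) hratio
  rw [Real.log_div hpos'.ne' (by positivity)] at hconst
  have hs2 : Real.sqrt 2 / 2 * Real.sqrt 2 = 1 := by
    rw [div_mul_eq_mul_div, Real.mul_self_sqrt (by norm_num)]; norm_num
  calc ∑ k ∈ Ico k₀ K', (k : ℝ) * (L k * h (m + k) ^ 3 / 2)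
      ≤ Real.sqrt 2 / 2 * (1 + (Real.log ((k₀ : ℝ) + K' - 1) - Real.log (2 * (k₀ : ℝ))) / 8) := h1
    _ ≤ Real.sqrt 2 / 2 * Real.sqrt 2 := mul_le_mul_of_nonneg_left hconst (by positivity)
    _ = 1 := hs2

/-! ## §2 Numerics of the window constants: spans `3`, `7`, `17` -/

/-- `√2∕2 ≤ 0.7071068` (`1.4142136² > 2`). [folklore] -/
theorem sqrt_two_div_two_le : Real.sqrt 2 / 2 ≤ 0.7071068 := by
  have : Real.sqrt 2 < 1.4142136 := by
    rw [Real.sqrt_lt' (by norm_num)]; norm_num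
  linarith

/-- `log 3 ≤ 1.1` (`e^{1.1} = e·e^{0.1} ≥ 2.7182818283·1.105 > 3`). [folklore] -/
theorem log_three_le : Real.log 3 ≤ 11 / 10 := by
  rw [Real.log_le_iff_le_exp (by norm_num)]
  have h1 := Real.exp_one_gt_d9
  have hq := Real.quadratic_le_exp_of_nonneg (show (0 : ℝ) ≤ 1 / 10 by norm_num)
  rw [show (11 : ℝ) / 10 = 1 + 1 / 10 by norm_num, Real.exp_add]
  nlinarith [h1, hq, Real.exp_pos (1 / 10), Real.exp_pos 1]

/-- Span `3`: `0 < x ≤ 2 ⟹ (√2∕2)(1 + ⅛·log x) ≤ 0.7684`. [folklore] -/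
theorem window_const_two {x : ℝ} (hx0 : 0 < x) (hx : x ≤ 2) : Real.sqrt 2 / 2 * (1 + Real.log x / 8) ≤ 0.7684 := by
  have hl : Real.log x ≤ Real.log 2 := Real.log_le_log hx0 hx
  have h2 := Real.log_two_lt_d9
  have hs := sqrt_two_div_two_le
  have hs0 : 0 ≤ Real.sqrt 2 / 2 := by positivity
  have hlx : Real.log x ≤ 0.6931471808 := by linarith
  calc Real.sqrt 2 / 2 * (1 + Real.log x / 8) ≤ Real.sqrt 2 / 2 * (1 + 0.6931471808 / 8) := by
        apply mul_le_mul_of_nonneg_left _ hs0; linarith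
    _ ≤ 0.7071068 * (1 + 0.6931471808 / 8) := mul_le_mul_of_nonneg_right hs (by norm_num)
    _ ≤ 0.7684 := by norm_num

/-- Span `7`: `0 < x ≤ 4 ⟹ (√2∕2)(1 + ⅛·log x) ≤ 0.83`. [folklore] -/
theorem window_const_four {x : ℝ} (hx0 : 0 < x) (hx : x ≤ 4) : Real.sqrt 2 / 2 * (1 + Real.log x / 8) ≤ 0.83 := by
  have hl : Real.log x ≤ Real.log 4 := Real.log_le_log hx0 hx
  have h4 : Real.log 4 = 2 * Real.log 2 := by
    rw [show (4 : ℝ) = 2 ^ 2 by norm_num, Real.log_pow]; push_cast; ring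
  have h2 := Real.log_two_lt_d9
  have hs := sqrt_two_div_two_le
  have hs0 : 0 ≤ Real.sqrt 2 / 2 := by positivity
  have hlx : Real.log x ≤ 2 * 0.6931471808 := by linarith
  calc Real.sqrt 2 / 2 * (1 + Real.log x / 8) ≤ Real.sqrt 2 / 2 * (1 + 2 * 0.6931471808 / 8) := by
        apply mul_le_mul_of_nonneg_left _ hs0; linarith
    _ ≤ 0.7071068 * (1 + 2 * 0.6931471808 / 8) := mul_le_mul_of_nonneg_right hs (by norm_num)
    _ ≤ 0.83 := by norm_num

/-- Span `17`: `0 < x ≤ 9 ⟹ (√2∕2)(1 + ⅛·log x) ≤ 0.902`. [folklore] -/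
theorem window_const_nine {x : ℝ} (hx0 : 0 < x) (hx : x ≤ 9) : Real.sqrt 2 / 2 * (1 + Real.log x / 8) ≤ 0.902 := by
  have hl : Real.log x ≤ Real.log 9 := Real.log_le_log hx0 hx
  have h9 : Real.log 9 = 2 * Real.log 3 := by
    rw [show (9 : ℝ) = 3 ^ 2 by norm_num, Real.log_pow]; push_cast; ring
  have h3 := log_three_le
  have hs := sqrt_two_div_two_le
  have hs0 : 0 ≤ Real.sqrt 2 / 2 := by positivity
  have hlx : Real.log x ≤ 2 * (11 / 10) := by linarith
  calc Real.sqrt 2 / 2 * (1 + Real.log x / 8) ≤ Real.sqrt 2 / 2 * (1 + 2 * (11 / 10) / 8) := by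
        apply mul_le_mul_of_nonneg_left _ hs0; linarith
    _ ≤ 0.7071068 * (1 + 2 * (11 / 10) / 8) := mul_le_mul_of_nonneg_right hs (by norm_num)
    _ ≤ 0.902 := by norm_num

/-! ## §3 One young age below an arbitrary dense cluster of bounded span: (E91c) with its cluster-load margin discharged -/

/-- **ONE YOUNG AGE FAR BELOW AN ARBITRARY CLUSTER OF BOUNDED SPAN.**  Profile carried by one young age `i ≥ 1` and ANY set of ages in `[k₀, K)` (`i < k₀ ≤ K`,
`L_l = 0` for the other `l < K`), isotone dominating memory with floor, box solution, damping of the self-consistent class `g_t(1+F_t) ≥ 1`; IF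
`(√2∕2)(1 + (log(k₀+K−1) − log(2k₀))∕8) ≤ 1 − δ` for some `0 < δ ≤ 1` with `10·i ≤ δ·k₀`, THEN `0 ≤ ε ≤ e` for every admissible excess and every horizon —
(E91c) `flow_nonneg_young_below_cluster` with its hypothesis `Σ_{j∈[k₀,K)} x_j(m) ≤ 1 − δ` DISCHARGED by `cluster_load_le_log`. [folklore] -/
theorem flow_nonneg_young_below_window_cluster (hmono : ∀ u v : ℕ → ℝ, SeqBox γ u → SeqBox γ v → (∀ j, u j ≤ v j) → B u ≤ B v)
    (hL : ∀ k, 0 ≤ L k) (hb : 0 < b) (hlo : ∀ u, SeqBox γ u → b ≤ B u) (hdom : ∀ u, SeqBox γ u → ∑ k ∈ range K, L k * u k ≤ B u)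
    (hh : SeqBox γ h) (hf : MemFlow B gIR h) (hg : ∀ t, 0 < g t ∧ g t ≤ 1)
    (hgF : ∀ t, 1 ≤ g t * (1 + ∑ k ∈ range K, L k * h (t + k) ^ 3 / 2))
    {i k₀ : ℕ} (hi : 1 ≤ i) (hik : i < k₀) (hk0K : k₀ ≤ K) (hLs : ∀ l, l < K → l ≠ i → l < k₀ → L l = 0)
    {δ : ℝ} (hδ : 0 < δ) (hδ1 : δ ≤ 1) (hfar : (10 : ℝ) * i ≤ δ * k₀)
    (hwin : Real.sqrt 2 / 2 * (1 + (Real.log ((k₀ : ℝ) + K - 1) - Real.log (2 * (k₀ : ℝ))) / 8) ≤ 1 - δ)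
    {N : ℕ} {KL : ℕ → ℕ → ℕ → ℝ}
    (hKL : ∀ k n l, KL k n l = if 0 < k ∧ k < K ∧ l < k then L k * h (n + k) ^ 3 / 2 * ∏ t ∈ Ico (n + 1 + l) (n + k + 1), g t else 0)
    {KA : ℕ → ℕ → ℕ → ℝ} {RA : ℕ → (ℕ → ℝ) → ℕ → ℝ}
    (hRA : ∀ i v m, RA i v m = ∑ l ∈ range K, KA i m l * v (m + 1 + l))
    (hKA : ∀ i m l, KA i m l = KL i m l + KA (i + 1) m l) (hKAtop : ∀ m l, KA K m l = 0)
    {e ε : ℕ → ℝ} (he0 : ∀ m, 0 ≤ e m) (hea : ∀ m, e (m + 1) ≤ e m)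
    (hεt : ∀ m, N < m → ε m = 0) (hεrec : ∀ m, ε m = e m - RA 1 ε m) : ∀ m, 0 ≤ ε m ∧ ε m ≤ e m := by
  have hpos : ∀ n, 0 < h n := fun n => (hh n).1
  have hk₀ : 1 ≤ k₀ := by omega
  have hold : ∀ m, ∑ j ∈ Ico k₀ K, (j : ℝ) * (L j * h (m + j) ^ 3 / 2) ≤ 1 - δ := by
    intro m
    rcases Nat.lt_or_ge k₀ K with hlt | hge
    · exact (cluster_load_le_log hmono hL hb hlo hdom hh hf hk₀ (by omega) le_rfl m).trans hwin
    · rw [Ico_eq_empty_of_le hge, sum_empty]; linarith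
  exact flow_nonneg_young_below_cluster hmono hL hb hlo hdom hh hf hg hgF hi hik hk0K hLs hδ hδ1 hfar hold hKL hRA hKA hKAtop he0 hea hεt hεrec

/-- **SPAN THREE: ONE YOUNG AGE `i` AND ANY SET OF AGES INSIDE `[k₀, 3k₀]`, `k₀ ≥ 44·i`** (`δ = 0.2316`: `(√2∕2)(1 + ⅛·log 2) ≤ 0.7684`, `0.2316·44 ≥ 10`).
[folklore] -/
theorem flow_nonneg_young_below_window_cluster_span_three (hmono : ∀ u v : ℕ → ℝ, SeqBox γ u → SeqBox γ v → (∀ j, u j ≤ v j) → B u ≤ B v)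
    (hL : ∀ k, 0 ≤ L k) (hb : 0 < b) (hlo : ∀ u, SeqBox γ u → b ≤ B u) (hdom : ∀ u, SeqBox γ u → ∑ k ∈ range K, L k * u k ≤ B u)
    (hh : SeqBox γ h) (hf : MemFlow B gIR h) (hg : ∀ t, 0 < g t ∧ g t ≤ 1)
    (hgF : ∀ t, 1 ≤ g t * (1 + ∑ k ∈ range K, L k * h (t + k) ^ 3 / 2))
    {i k₀ : ℕ} (hi : 1 ≤ i) (hik : 44 * i ≤ k₀) (hk0K : k₀ ≤ K) (hK3 : K ≤ 3 * k₀ + 1) (hLs : ∀ l, l < K → l ≠ i → l < k₀ → L l = 0)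
    {N : ℕ} {KL : ℕ → ℕ → ℕ → ℝ}
    (hKL : ∀ k n l, KL k n l = if 0 < k ∧ k < K ∧ l < k then L k * h (n + k) ^ 3 / 2 * ∏ t ∈ Ico (n + 1 + l) (n + k + 1), g t else 0)
    {KA : ℕ → ℕ → ℕ → ℝ} {RA : ℕ → (ℕ → ℝ) → ℕ → ℝ}
    (hRA : ∀ i v m, RA i v m = ∑ l ∈ range K, KA i m l * v (m + 1 + l))
    (hKA : ∀ i m l, KA i m l = KL i m l + KA (i + 1) m l) (hKAtop : ∀ m l, KA K m l = 0)
    {e ε : ℕ → ℝ} (he0 : ∀ m, 0 ≤ e m) (hea : ∀ m, e (m + 1) ≤ e m)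
    (hεt : ∀ m, N < m → ε m = 0) (hεrec : ∀ m, ε m = e m - RA 1 ε m) : ∀ m, 0 ≤ ε m ∧ ε m ≤ e m := by
  have hir : (1 : ℝ) ≤ i := by exact_mod_cast hi
  have hikr : (44 : ℝ) * i ≤ k₀ := by exact_mod_cast hik
  have hk0r : (0 : ℝ) < k₀ := by linarith
  have hKr : ((K : ℕ) : ℝ) ≤ ((3 * k₀ + 1 : ℕ) : ℝ) := by exact_mod_cast hK3
  have hKk : ((k₀ : ℕ) : ℝ) ≤ ((K : ℕ) : ℝ) := by exact_mod_cast hk0K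
  push_cast at hKr hKk
  have hx0 : (0 : ℝ) < ((k₀ : ℝ) + K - 1) / (2 * (k₀ : ℝ)) := by apply div_pos <;> linarith
  have hx2 : ((k₀ : ℝ) + K - 1) / (2 * (k₀ : ℝ)) ≤ 2 := by rw [div_le_iff₀ (by positivity)]; linarith
  have hwin := window_const_two hx0 hx2
  rw [Real.log_div (by linarith) (by positivity)] at hwin
  refine flow_nonneg_young_below_window_cluster hmono hL hb hlo hdom hh hf hg hgF hi (by omega) hk0K hLs (δ := 0.2316) (by norm_num) (by norm_num)
    (by nlinarith) (by linarith) hKL hRA hKA hKAtop he0 hea hεt hεrec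

/-- **SPAN SEVEN: ONE YOUNG AGE `i` AND ANY SET OF AGES INSIDE `[k₀, 7k₀]`, `k₀ ≥ 59·i`** (`δ = 0.17`: `(√2∕2)(1 + ⅛·log 4) ≤ 0.83`, `0.17·59 ≥ 10`). [folklore] -/
theorem flow_nonneg_young_below_window_cluster_span_seven (hmono : ∀ u v : ℕ → ℝ, SeqBox γ u → SeqBox γ v → (∀ j, u j ≤ v j) → B u ≤ B v)
    (hL : ∀ k, 0 ≤ L k) (hb : 0 < b) (hlo : ∀ u, SeqBox γ u → b ≤ B u) (hdom : ∀ u, SeqBox γ u → ∑ k ∈ range K, L k * u k ≤ B u)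
    (hh : SeqBox γ h) (hf : MemFlow B gIR h) (hg : ∀ t, 0 < g t ∧ g t ≤ 1)
    (hgF : ∀ t, 1 ≤ g t * (1 + ∑ k ∈ range K, L k * h (t + k) ^ 3 / 2))
    {i k₀ : ℕ} (hi : 1 ≤ i) (hik : 59 * i ≤ k₀) (hk0K : k₀ ≤ K) (hK7 : K ≤ 7 * k₀ + 1) (hLs : ∀ l, l < K → l ≠ i → l < k₀ → L l = 0)
    {N : ℕ} {KL : ℕ → ℕ → ℕ → ℝ}
    (hKL : ∀ k n l, KL k n l = if 0 < k ∧ k < K ∧ l < k then L k * h (n + k) ^ 3 / 2 * ∏ t ∈ Ico (n + 1 + l) (n + k + 1), g t else 0)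
    {KA : ℕ → ℕ → ℕ → ℝ} {RA : ℕ → (ℕ → ℝ) → ℕ → ℝ}
    (hRA : ∀ i v m, RA i v m = ∑ l ∈ range K, KA i m l * v (m + 1 + l))
    (hKA : ∀ i m l, KA i m l = KL i m l + KA (i + 1) m l) (hKAtop : ∀ m l, KA K m l = 0)
    {e ε : ℕ → ℝ} (he0 : ∀ m, 0 ≤ e m) (hea : ∀ m, e (m + 1) ≤ e m)
    (hεt : ∀ m, N < m → ε m = 0) (hεrec : ∀ m, ε m = e m - RA 1 ε m) : ∀ m, 0 ≤ ε m ∧ ε m ≤ e m := by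
  have hir : (1 : ℝ) ≤ i := by exact_mod_cast hi
  have hikr : (59 : ℝ) * i ≤ k₀ := by exact_mod_cast hik
  have hk0r : (0 : ℝ) < k₀ := by linarith
  have hKr : ((K : ℕ) : ℝ) ≤ ((7 * k₀ + 1 : ℕ) : ℝ) := by exact_mod_cast hK7
  have hKk : ((k₀ : ℕ) : ℝ) ≤ ((K : ℕ) : ℝ) := by exact_mod_cast hk0K
  push_cast at hKr hKk
  have hx0 : (0 : ℝ) < ((k₀ : ℝ) + K - 1) / (2 * (k₀ : ℝ)) := by apply div_pos <;> linarith
  have hx4 : ((k₀ : ℝ) + K - 1) / (2 * (k₀ : ℝ)) ≤ 4 := by rw [div_le_iff₀ (by positivity)]; linarith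
  have hwin := window_const_four hx0 hx4
  rw [Real.log_div (by linarith) (by positivity)] at hwin
  refine flow_nonneg_young_below_window_cluster hmono hL hb hlo hdom hh hf hg hgF hi (by omega) hk0K hLs (δ := 0.17) (by norm_num) (by norm_num)
    (by nlinarith) (by linarith) hKL hRA hKA hKAtop he0 hea hεt hεrec

/-- **SPAN SEVENTEEN: ONE YOUNG AGE `i` AND ANY SET OF AGES INSIDE `[k₀, 17k₀]`, `k₀ ≥ 103·i`** (`δ = 0.098`: `(√2∕2)(1 + ⅛·log 9) ≤ 0.902`, `0.098·103 ≥ 10`).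
[folklore] -/
theorem flow_nonneg_young_below_window_cluster_span_seventeen (hmono : ∀ u v : ℕ → ℝ, SeqBox γ u → SeqBox γ v → (∀ j, u j ≤ v j) → B u ≤ B v)
    (hL : ∀ k, 0 ≤ L k) (hb : 0 < b) (hlo : ∀ u, SeqBox γ u → b ≤ B u) (hdom : ∀ u, SeqBox γ u → ∑ k ∈ range K, L k * u k ≤ B u)
    (hh : SeqBox γ h) (hf : MemFlow B gIR h) (hg : ∀ t, 0 < g t ∧ g t ≤ 1)
    (hgF : ∀ t, 1 ≤ g t * (1 + ∑ k ∈ range K, L k * h (t + k) ^ 3 / 2))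
    {i k₀ : ℕ} (hi : 1 ≤ i) (hik : 103 * i ≤ k₀) (hk0K : k₀ ≤ K) (hK17 : K ≤ 17 * k₀ + 1) (hLs : ∀ l, l < K → l ≠ i → l < k₀ → L l = 0)
    {N : ℕ} {KL : ℕ → ℕ → ℕ → ℝ}
    (hKL : ∀ k n l, KL k n l = if 0 < k ∧ k < K ∧ l < k then L k * h (n + k) ^ 3 / 2 * ∏ t ∈ Ico (n + 1 + l) (n + k + 1), g t else 0)
    {KA : ℕ → ℕ → ℕ → ℝ} {RA : ℕ → (ℕ → ℝ) → ℕ → ℝ}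
    (hRA : ∀ i v m, RA i v m = ∑ l ∈ range K, KA i m l * v (m + 1 + l))
    (hKA : ∀ i m l, KA i m l = KL i m l + KA (i + 1) m l) (hKAtop : ∀ m l, KA K m l = 0)
    {e ε : ℕ → ℝ} (he0 : ∀ m, 0 ≤ e m) (hea : ∀ m, e (m + 1) ≤ e m)
    (hεt : ∀ m, N < m → ε m = 0) (hεrec : ∀ m, ε m = e m - RA 1 ε m) : ∀ m, 0 ≤ ε m ∧ ε m ≤ e m := by
  have hir : (1 : ℝ) ≤ i := by exact_mod_cast hi
  have hikr : (103 : ℝ) * i ≤ k₀ := by exact_mod_cast hik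
  have hk0r : (0 : ℝ) < k₀ := by linarith
  have hKr : ((K : ℕ) : ℝ) ≤ ((17 * k₀ + 1 : ℕ) : ℝ) := by exact_mod_cast hK17
  have hKk : ((k₀ : ℕ) : ℝ) ≤ ((K : ℕ) : ℝ) := by exact_mod_cast hk0K
  push_cast at hKr hKk
  have hx0 : (0 : ℝ) < ((k₀ : ℝ) + K - 1) / (2 * (k₀ : ℝ)) := by apply div_pos <;> linarith
  have hx9 : ((k₀ : ℝ) + K - 1) / (2 * (k₀ : ℝ)) ≤ 9 := by rw [div_le_iff₀ (by positivity)]; linarith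
  have hwin := window_const_nine hx0 hx9
  rw [Real.log_div (by linarith) (by positivity)] at hwin
  refine flow_nonneg_young_below_window_cluster hmono hL hb hlo hdom hh hf hg hgF hi (by omega) hk0K hLs (δ := 0.098) (by norm_num) (by norm_num)
    (by nlinarith) (by linarith) hKL hRA hKA hKAtop he0 hea hεt hεrec

end Summit.QuantumFields.BalabanUV.Beta.EriceRemainderEnclosureHistoryAutonomyComparisonAgeCompositionAgeRatioWindowClusters

end
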